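import Literature.NumberTheory.Rogawski1990.ArchCentralValueTransferDiagonalOfLetter  -- ★ p842658 (this seat): `archCentralValueTransferExists_canonical_of_letter`
import Literature.NumberTheory.Rogawski1990.ArchCentralValueTransferExistsVacuous    -- ★ (F0P3a-p06 (g9)): the vacuous frames of (S-d)
import HarnessLib

/-!
# (S-d) CLOSED BY NAME FROM THE (L_{U(2,1)}) LETTER — `ArchCentralValueTransferExistsClosed` (the text of the closer's `stub_Sd` of `Cruxes/H413/F0U3LettersRung1.lean`) modulo
# `ArchCentralLimitFormulaRankTwo` alone (Rogawski 1990 §14.5 p. 239, §8.4 pp. 126–127, §1.7 p. 6)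

Topic `NumberTheory/Rogawski1990`; namespace `Literature.NumberTheory.Rogawski1990`.  ONE THEOREM (no `def`, no instance, no notation, no axiom, no named fact, no `sorry`).
Cell `pub/hodgecm-mathlib`, ENGINE T1 (crux H413 = `stmt-HodgeConjecture-24833`); ROAD-Sd, «SdArch» ED. 3 (F0P3a-p03 (g11)); the Literature-side twin of the Lines file's plumbing
`archCentralValueTransferExistsClosed_of` (LINK for the closer, pattern ★ p842045 `archTransfersSingularOfCanonicalClosed_of_centralVanishing` for (S-c)): the canonical frames are ★
`archCentralValueTransferExists_canonical_of_letter hL21`, every other frame is vacuous (★ `archCentralValueTransferExists_of_not_isHermitian ∕ _anisotropic ∕ _exists_posDef ∕ _isArchNondegenerate`).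
CONDITIONAL on the letter `hL21` (printed-hard, floor 2; ROAD A) and on nothing else.
HONEST LABEL: HC_CM is proved only modulo the printed citations until rung 0 closes; this file discharges the closer's (S-d) row down to the ONE letter (L_{U(2,1)}).

## References
* [Rogawski1990] J. D. Rogawski, *Automorphic Representations of Unitary Groups in Three Variables*, Ann. of Math. Stud. 123 (1990), §14.5 p. 239, §8.4 pp. 126–127, §1.7 p. 6.
-/

set_option autoImplicit false

noncomputable section

open MeasureTheory Measure NumberField NumberField.InfinitePlace
open Literature.MeasureTheory.Group

namespace Literature.NumberTheory.Rogawski1990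

open Literature.NumberTheory.Automorphic
open Literature.AlgebraicGeometry.ShimuraVarieties (unitaryGroup hermForm)
open scoped Matrix ComplexOrder MatrixGroups

/-- **(S-d) CLOSED, MODULO THE (L_{U(2,1)}) LETTER**: `ArchCentralValueTransferExistsClosed` (= the closer's `stub_Sd` BY NAME) from `hL21 : ∀ L α w, ArchCentralLimitFormulaRankTwo L α w` —
the canonical frames by ★ `archCentralValueTransferExists_canonical_of_letter`, the degenerate ones by the ★ vacuous frames (`by_cases` on the three guards and (iv)).
[cite: Rogawski1990, §14.5 p. 239; §8.4 pp. 126–127; §1.7 p. 6] -/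
theorem archCentralValueTransferExistsClosed_of_letter
    (hL21 : ∀ (L : Type) [Field L] (α : Fin 3 → L) (w : {w : InfinitePlace L // IsComplex w}), ArchCentralLimitFormulaRankTwo L α w) :
    ArchCentralValueTransferExistsClosed := by
  intro L _ _ _ H' T _ _ _ _ _ _ ν' νH _ _ _ _
  by_cases hherm : (H'.map (cmConjRingHom L)).transpose = H'
  · by_cases hanis : ∀ x : Fin 3 → L, hermForm (cmConjRingHom L) H' x x = 0 → x = 0
    · by_cases hS₀ : ∃ w : {w : InfinitePlace L // IsComplex w}, (H'.map w.1.embedding).PosDef ∨ (-H'.map w.1.embedding).PosDef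
      · by_cases hnd : IsArchNondegenerate L H' T
        · exact archCentralValueTransferExists_canonical_of_letter hL21 L H' T ν' νH hherm hanis hS₀ hnd
        · exact archCentralValueTransferExists_of_not_isArchNondegenerate L H' T ν' νH hnd
      · exact archCentralValueTransferExists_of_not_exists_posDef L H' T ν' νH hS₀
    · exact archCentralValueTransferExists_of_not_anisotropic L H' T ν' νH hanis
  · exact archCentralValueTransferExists_of_not_isHermitian L H' T ν' νH hherm

end Literature.NumberTheory.Rogawski1990

end
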